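import Summits.CriticalPhenomena.Ising3DConformalLimit.Theorems.RotationUpgradeFromTwoPoint.Negative.AutomaticOrders
import Summits.CriticalPhenomena.Ising3DConformalLimit.Theorems.MoebiusLimitExists.Negative.MeshContinuity
import Summits.CriticalPhenomena.Ising3DConformalLimit.Theorems.HyperoctahedralRPInversionUpgradeNormalisedEvenPos
import Summits.CriticalPhenomena.Ising3DConformalLimit.Theorems.HyperoctahedralRPInversionUpgradeNormalisedOSLayer
import Literature.Probability.LatticeModels.CriticalUrsellFourSign
import Literature.Analysis.FluidPDE.HarmonicVanishing
import Literature.Analysis.FluidPDE.HarmonicRemovableSingularity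
import Literature.Analysis.FluidPDE.HarmonicAnalyticContinuation
import HarnessLib

/-!
# Stub `stub_edgeBocherLiouville` of line `null-laplacian-edge-gaussianity` for crux
# `RotationUpgradeFromTwoPoint` (stmt-CriticalPhenomena-8367): at the edge `Δ = 1/2`, `U₄ ≡ 0`

Statement (STUB 4 of the line skeleton). Let `S` be a normalised, non-degenerate, translation-
invariant, scale-covariant pointwise scaling limit of the critical `ℤ³` Ising correlators
`criticalCorr 3` (renormalisation `ρ > 0` on `(0,1]`) with round two-point function and `Δ = 1/2`,
and assume for every injective `y : Fin 3 → ℝ³`: (a) `x ↦ S₄(x, y)` is harmonic at every `u`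
strictly separated from `y` along a lattice normal; (b) `x ↦ S₄(x, y)` is real-analytic off
`range y ∪ F`, `F` finite. Then `U₄ = limitConnectedFour S` vanishes at non-coincident quadruples.

Proof (potential theory of the one function `f = S₄(·, y)`, `y = (z₁, z₂, z₃)`).
1. FLOODING. `f` is real-analytic on the open connected `Ω = (range y ∪ F)ᶜ` and harmonic at an
   exterior point `u ∈ Ω` far out along `-e₀` ((a) with the normal `e₀`), hence harmonic on `Ω`
   (identity theorem for `Δ f`: tree `harmonicOnNhd_of_analyticOnNhd_of_harmonicAt`).
2. REMOVABILITY. `f` is continuous off `range y` (`LimitMeshContinuity.continuousOn_limit`), so the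
   isolated points of `F ∖ range y` are removable (tree
   `harmonicAt_of_harmonic_punctured_of_continuousAt`, `d = 3`): `f` is harmonic on `ℝ³ ∖ y`.
3. WICK PART. `S₂(a, b) = A‖a - b‖⁻¹` (`two_point_law` at `Δ = 1/2`) is harmonic in `a ≠ b`, so
   `U(x) = U₄(x, y) = f(x) - Σ_pairings` is harmonic on `ℝ³ ∖ y`.
4. SQUEEZE. Lebowitz in the limit (`limitConnectedFour_nonpos_of_hasPointwiseScalingLimit`):
   `U ≤ 0`; GKS II in the limit (`rescaledCorrelator_split_le` + permutation symmetry): one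
   pairing `S₂(x, yᵢ)S₂(yⱼ, y_k) ≤ f(x)`. So `|U|` is at most the two pairings regular at `yᵢ`:
   `U` is bounded near each `yᵢ` and `|U| → 0` at infinity.
5. LIOUVILLE. The three bounded isolated singularities are removable (tree
   `exists_harmonicOnNhd_univ_eq_of_finset`): `U` agrees off `y` with an entire harmonic `V → 0`
   at infinity, so `V = 0` (tree `harmonic_eq_zero_of_tendsto_cocompact`) and `U₄(z) = U(z₀) = 0`.
(A Gaussian scale mixture — RP, round, `Δ = 1/2`, `U₄ ≥ 0` — is excluded exactly by the Lebowitz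
sign: the lattice hypothesis (H2) is used.) References: M. Aizenman, Comm. Math. Phys. 86 (1982),
§5 (Lebowitz); S. Friedli, Y. Velenik, *Statistical Mechanics of Lattice Systems* (2017), Thm. 3.20
(GKS II); S. Axler, P. Bourdon, W. Ramey, *Harmonic Function Theory* (2001), Thm. 2.3, Liouville.
-/

noncomputable section

open Filter Topology Metric Set Function InnerProductSpace
open Literature.Probability.LatticeModels Literature.Analysis.FluidPDE
open Literature.Barriers.CriticalPhenomena.ScaleNotMoebius (axisUnit)
open Summit.CriticalPhenomena.Ising3DConformalLimit.RotationUpgradeFromTwoPointNegative (two_point_law)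
open Summit.CriticalPhenomena.Ising3DConformalLimit.Cruxes.InversionUpgradeNormalised.InversionDefectInvolution
  (rescaledCorrelator_split_le)
open Summit.CriticalPhenomena.Ising3DConformalLimit.Cruxes.InversionUpgradeNormalised.FreeEndpointGaussianClosure
  (isPermutationSymmetric_of_limit)

namespace Summit.CriticalPhenomena.Ising3DConformalLimit.Cruxes.RotationUpgradeFromTwoPoint.NullLaplacianEdgeGaussianity

variable {ρ : ℝ → ℝ} {S : CorrFamily 3} {y : Fin 3 → EuclideanSpace ℝ (Fin 3)}
  {x q x₀ : EuclideanSpace ℝ (Fin 3)} {w : Fin 4 → EuclideanSpace ℝ (Fin 3)}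
  (hlim : HasPointwiseScalingLimit (criticalCorr 3) ρ S)
  (hnorm : ∀ n z, z ∉ NonCoincident 3 n → S n z = 0)
  (htr : IsTranslationInvariant S) (hsc : IsScaleCovariant (1 / 2) S)
  (hiso : ∀ (R : EuclideanSpace ℝ (Fin 3) ≃ₗᵢ[ℝ] EuclideanSpace ℝ (Fin 3))
    (x : EuclideanSpace ℝ (Fin 3)), x ≠ 0 → S 2 ![0, R x] = S 2 ![0, x])
  (hext : ∀ (y : Fin 3 → EuclideanSpace ℝ (Fin 3)), Function.Injective y →
    ∀ n : EuclideanSpace ℝ (Fin 3),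
    (∃ i j : Fin 3, i ≠ j ∧ (n = EuclideanSpace.single i 1 ∨
      n = EuclideanSpace.single i 1 + EuclideanSpace.single j 1 ∨
      n = EuclideanSpace.single i 1 - EuclideanSpace.single j 1)) →
    ∀ u : EuclideanSpace ℝ (Fin 3),
      ((∀ i, inner ℝ u n < inner ℝ (y i) n) ∨ (∀ i, inner ℝ (y i) n < inner ℝ u n)) →
      HarmonicAt (fun x => S 4 (Fin.cons x y)) u)
  (hanF : ∀ (y : Fin 3 → EuclideanSpace ℝ (Fin 3)), Function.Injective y →
    ∃ F : Finset (EuclideanSpace ℝ (Fin 3)),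
      AnalyticOnNhd ℝ (fun x => S 4 (Fin.cons x y))
        (Set.range y ∪ (F : Set (EuclideanSpace ℝ (Fin 3))))ᶜ)

/-! ### Configurations `(x, y₀, y₁, y₂)`: continuity, Lebowitz and GKS II in the limit -/

/-- `(x, y)` is non-coincident when `y` is injective and `x ∉ range y`. -/
theorem cons_mem_nonCoincident (hy : Injective y) (hx : x ∉ range y) :
    (Fin.cons x y : Fin 4 → _) ∈ NonCoincident 3 4 :=
  Fin.cons_injective_iff.2 ⟨hx, hy⟩

include hlim in
/-- `x ↦ S₄(x, y)` is continuous at every `x ∉ range y` (the limit is continuous on non-coincident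
configurations, `LimitMeshContinuity.continuousOn_limit`). -/
theorem continuousAt_four_cons (hy : Injective y) (hx : x ∉ range y) :
    ContinuousAt (fun x => S 4 (Fin.cons x y)) x := by
  have hc : Continuous fun x : EuclideanSpace ℝ (Fin 3) => (Fin.cons x y : Fin 4 → _) := by
    refine continuous_pi fun i => Fin.cases ?_ (fun j => ?_) i
    · simp only [Fin.cons_zero]; exact continuous_id
    · simp only [Fin.cons_succ]; exact continuous_const
  have h1 : ContinuousAt (S 4) (Fin.cons x y) :=
    (LimitMeshContinuity.continuousOn_limit hlim 4).continuousAt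
      ((isOpen_nonCoincident 3 4).mem_nhds (cons_mem_nonCoincident hy hx))
  exact ContinuousAt.comp (f := fun x : EuclideanSpace ℝ (Fin 3) => (Fin.cons x y : Fin 4 → _)) h1
    hc.continuousAt

include hlim in
/-- `x ↦ S₂(x, q)` is continuous at every `x ≠ q`. -/
theorem continuousAt_two_left (hx : x ≠ q) : ContinuousAt (fun x => S 2 ![x, q]) x := by
  have hc : Continuous fun x : EuclideanSpace ℝ (Fin 3) => (![x, q] : Fin 2 → _) :=
    continuous_id.matrixVecCons continuous_const
  have h1 : ContinuousAt (S 2) ![x, q] :=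
    (LimitMeshContinuity.continuousOn_limit hlim 2).continuousAt
      ((isOpen_nonCoincident 3 2).mem_nhds (pair_mem_nonCoincident hx))
  exact ContinuousAt.comp (f := fun x : EuclideanSpace ℝ (Fin 3) => (![x, q] : Fin 2 → _)) h1
    hc.continuousAt

/-- Unfolding `U₄(x, y₀, y₁, y₂) = S₄(x, y) - Σ_pairings`. -/
theorem limitConnectedFour_cons (S : CorrFamily 3) (x : EuclideanSpace ℝ (Fin 3))
    (y : Fin 3 → EuclideanSpace ℝ (Fin 3)) :
    limitConnectedFour S (Fin.cons x y) = S 4 (Fin.cons x y) - (S 2 ![x, y 0] * S 2 ![y 1, y 2] +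
      S 2 ![x, y 1] * S 2 ![y 0, y 2] + S 2 ![x, y 2] * S 2 ![y 0, y 1]) := rfl

include hlim in
/-- **Lebowitz in the limit**: `U₄(x, y) ≤ 0` for `x ∉ range y`. -/
theorem connectedFour_cons_nonpos (hy : Injective y) (hx : x ∉ range y) :
    limitConnectedFour S (Fin.cons x y) ≤ 0 :=
  limitConnectedFour_nonpos_of_hasPointwiseScalingLimit le_rfl hlim (cons_mem_nonCoincident hy hx)

include hlim in
/-- **GKS II in the limit**: `S₂(w₀, w₁) S₂(w₂, w₃) ≤ S₄(w)` at every non-coincident `w`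
(`rescaledCorrelator_split_le` at every mesh, then `δ → 0⁺`). -/
theorem pairing_le_four (hw : w ∈ NonCoincident 3 4) :
    S 2 ![w 0, w 1] * S 2 ![w 2, w 3] ≤ S 4 w := by
  have hinj : Injective w := hw
  have e1 : (fun i : Fin 2 => w (Fin.castAdd 2 i)) = ![w 0, w 1] := by funext i; fin_cases i <;> rfl
  have e2 : (fun i : Fin 2 => w (Fin.natAdd 2 i)) = ![w 2, w 3] := by funext i; fin_cases i <;> rfl
  have h01 : (![w 0, w 1] : Fin 2 → _) ∈ NonCoincident 3 2 :=
    pair_mem_nonCoincident (hinj.ne (by decide))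
  have h23 : (![w 2, w 3] : Fin 2 → _) ∈ NonCoincident 3 2 :=
    pair_mem_nonCoincident (hinj.ne (by decide))
  refine le_of_tendsto_of_tendsto' (((hlim 2).tendsto_at h01).mul ((hlim 2).tendsto_at h23))
    ((hlim 4).tendsto_at hw) fun δ => ?_
  have key := rescaledCorrelator_split_le ρ (m := 2) (by decide) δ w
  rwa [e1, e2] at key

include hlim hnorm in
/-- **GKS II in the limit for the three pairings of `(x, y₀, y₁, y₂)`**: each single pairing
`S₂(x, yᵢ) S₂(yⱼ, y_k)` is `≤ S₄(x, y)` (`pairing_le_four` at a permuted configuration and the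
permutation symmetry of the limit, `isPermutationSymmetric_of_limit`). -/
theorem pairings_le_four_cons (hy : Injective y) (hx : x ∉ range y) :
    S 2 ![x, y 0] * S 2 ![y 1, y 2] ≤ S 4 (Fin.cons x y) ∧
      S 2 ![x, y 1] * S 2 ![y 0, y 2] ≤ S 4 (Fin.cons x y) ∧
      S 2 ![x, y 2] * S 2 ![y 0, y 1] ≤ S 4 (Fin.cons x y) := by
  have hz := cons_mem_nonCoincident hy hx
  have hinj : Injective (Fin.cons x y : Fin 4 → _) := hz
  have hsymm := isPermutationSymmetric_of_limit hlim hnorm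
  refine ⟨pairing_le_four hlim hz, ?_, ?_⟩
  · set w : Fin 4 → EuclideanSpace ℝ (Fin 3) := ![x, y 1, y 0, y 2] with hw
    have hwσ : w = (Fin.cons x y : Fin 4 → _) ∘ Equiv.swap (1 : Fin 4) 2 := by
      funext i; fin_cases i <;> rfl
    have hwz : w ∈ NonCoincident 3 4 := by rw [hwσ]; exact hinj.comp (Equiv.injective _)
    calc S 2 ![x, y 1] * S 2 ![y 0, y 2] = S 2 ![w 0, w 1] * S 2 ![w 2, w 3] := rfl
      _ ≤ S 4 w := pairing_le_four hlim hwz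
      _ = S 4 (Fin.cons x y) := by rw [hwσ]; exact hsymm 4 _ _
  · set w : Fin 4 → EuclideanSpace ℝ (Fin 3) := ![x, y 2, y 0, y 1] with hw
    have hwσ : w = (Fin.cons x y : Fin 4 → _) ∘
        (Equiv.swap (2 : Fin 4) 3 * Equiv.swap (1 : Fin 4) 2) := by funext i; fin_cases i <;> rfl
    have hwz : w ∈ NonCoincident 3 4 := by rw [hwσ]; exact hinj.comp (Equiv.injective _)
    calc S 2 ![x, y 2] * S 2 ![y 0, y 1] = S 2 ![w 0, w 1] * S 2 ![w 2, w 3] := rfl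
      _ ≤ S 4 w := pairing_le_four hlim hwz
      _ = S 4 (Fin.cons x y) := by rw [hwσ]; exact hsymm 4 _ _

/-! ### The round two-point function at the edge `Δ = 1/2` -/

include htr hsc hiso in
/-- At the edge `Δ = 1/2` the round two-point function is the Newtonian potential,
`S₂(a, b) = S₂(0, e₀) ‖a - b‖⁻¹` for `a ≠ b` (`two_point_law`). -/
theorem two_point_edge {a b : EuclideanSpace ℝ (Fin 3)} (hab : a ≠ b) :
    S 2 ![a, b] = S 2 ![0, axisUnit] * ‖a - b‖⁻¹ := by
  rw [two_point_law htr hsc hiso hab, show (-(2 * (1 / 2 : ℝ))) = -1 by norm_num,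
    Real.rpow_neg_one, mul_comm]

include htr hsc hiso in
/-- Hence `x ↦ S₂(x, q)` is HARMONIC at every `x ≠ q` (`‖x - q‖⁻¹` is harmonic off `q` in `ℝ³`:
tree `harmonicAt_norm_sub_sq_rpow` in dimension `3`). -/
theorem harmonicAt_two_left (hx : x ≠ q) : HarmonicAt (fun x => S 2 ![x, q]) x := by
  have hev : (fun x => S 2 ![x, q]) =ᶠ[𝓝 x] fun x => S 2 ![0, axisUnit] * ‖x - q‖⁻¹ := by
    filter_upwards [isOpen_ne.mem_nhds hx] with w hw using two_point_edge htr hsc hiso hw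
  rw [harmonicAt_congr_nhds hev]
  have hk := harmonicAt_norm_sub_sq_rpow q hx
  rw [finrank_euclideanSpace_fin] at hk
  have e : (fun w : EuclideanSpace ℝ (Fin 3) => (‖w - q‖ ^ 2) ^ (-((((3 : ℕ) : ℝ) - 2) / 2))) =
      fun w => ‖w - q‖⁻¹ := by
    funext w
    rw [show (-((((3 : ℕ) : ℝ) - 2) / 2) : ℝ) = -(1 / 2) by norm_num, Real.rpow_neg (sq_nonneg _),
      ← Real.sqrt_eq_rpow, Real.sqrt_sq (norm_nonneg _)]
  rw [e] at hk
  simpa only [Pi.smul_def, smul_eq_mul] using hk.const_smul (c := S 2 ![0, axisUnit])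

include htr hsc hiso in
/-- And `S₂(x, q) c → 0` as `‖x‖ → ∞`. -/
theorem tendsto_two_left_cocompact (q : EuclideanSpace ℝ (Fin 3)) (c : ℝ) :
    Tendsto (fun x => S 2 ![x, q] * c) (cocompact (EuclideanSpace ℝ (Fin 3))) (𝓝 0) := by
  have h0 := tendsto_atTop_add_const_right (cocompact _) (-‖q‖)
    (tendsto_norm_cocompact_atTop (E := EuclideanSpace ℝ (Fin 3)))
  have h1 : Tendsto (fun x : EuclideanSpace ℝ (Fin 3) => ‖x - q‖) (cocompact _) atTop :=
    tendsto_atTop_mono (fun x => by linarith [norm_sub_norm_le x q]) h0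
  have h2 : Tendsto (fun x : EuclideanSpace ℝ (Fin 3) => S 2 ![0, axisUnit] * ‖x - q‖⁻¹ * c)
      (cocompact _) (𝓝 0) := by
    simpa using (h1.inv_tendsto_atTop.const_mul (S 2 ![0, axisUnit])).mul_const c
  refine h2.congr' ?_
  filter_upwards [isCompact_singleton.compl_mem_cocompact] with x (hx : x ∉ ({q} : Set _))
  rw [two_point_edge htr hsc hiso hx]

/-! ### Harmonicity of `S₄(·, y)` and of `U₄(·, y)` off `range y`; the edge theorem -/

include hlim hext hanF in
/-- **Steps 1–2: `x ↦ S₄(x, y)` is harmonic at every `x ∉ range y`.** FLOODING: with `F` from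
the analyticity hypothesis, `Ω = (range y ∪ F)ᶜ` is open and preconnected (complement of a finite
set in `ℝ³`) and contains an exterior point `u` far out along `-e₀` where the exterior-harmonicity
hypothesis applies, so harmonicity propagates to all of `Ω`
(`harmonicOnNhd_of_analyticOnNhd_of_harmonicAt`). REMOVABILITY: at a point of `F ∖ range y` the
function is continuous (`continuousAt_four_cons`) and harmonic on a punctured ball, hence harmonic
(`harmonicAt_of_harmonic_punctured_of_continuousAt`, `d = 3`). -/
theorem harmonicAt_four_cons (hy : Injective y) (hx : x ∉ range y) :
    HarmonicAt (fun x => S 4 (Fin.cons x y)) x := by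
  classical
  obtain ⟨F, hFan⟩ := hanF y hy
  have hfin : (range y ∪ (F : Set _)).Finite := (finite_range y).union F.finite_toSet
  set Ω : Set (EuclideanSpace ℝ (Fin 3)) := (range y ∪ (F : Set _))ᶜ with hΩ
  have hΩo : IsOpen Ω := hfin.isClosed.isOpen_compl
  have hΩc : IsPreconnected Ω := by
    have hr : 1 < Module.rank ℝ (EuclideanSpace ℝ (Fin 3)) := by
      rw [← Module.finrank_eq_rank ℝ (EuclideanSpace ℝ (Fin 3)), finrank_euclideanSpace_fin]
      norm_num
    exact (Set.Countable.isPathConnected_compl_of_one_lt_rank hr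
      hfin.countable).isConnected.isPreconnected
  -- an exterior point of `Ω` along `-e₀`
  set e₀ : EuclideanSpace ℝ (Fin 3) := EuclideanSpace.single 0 1 with he₀
  set V : Set (EuclideanSpace ℝ (Fin 3)) := {u | ∀ i, inner ℝ u e₀ < inner ℝ (y i) e₀} with hV
  have hVo : IsOpen V := by
    rw [hV, setOf_forall]
    exact isOpen_iInter_of_finite fun i =>
      isOpen_lt (continuous_id.inner continuous_const) continuous_const
  have hVne : V.Nonempty := by
    refine ⟨(-(∑ i, |inner ℝ (y i) e₀|) - 1) • e₀, fun i => ?_⟩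
    have he₁ : ‖e₀‖ = 1 := by simp [he₀]
    have h2 : -|inner ℝ (y i) e₀| ≤ inner ℝ (y i) e₀ := neg_abs_le _
    have h3 : |inner ℝ (y i) e₀| ≤ ∑ j, |inner ℝ (y j) e₀| :=
      Finset.single_le_sum (f := fun j => |inner ℝ (y j) e₀|) (fun j _ => abs_nonneg _)
        (Finset.mem_univ i)
    show inner ℝ (_ • e₀) e₀ < inner ℝ (y i) e₀
    rw [real_inner_smul_left, real_inner_self_eq_norm_sq, he₁, one_pow, mul_one]
    linarith
  obtain ⟨u, huV, huF⟩ := (dense_univ.sdiff_finite F.finite_toSet).inter_open_nonempty V hVo hVne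
  have huΩ : u ∈ Ω := by
    rw [hΩ, mem_compl_iff, mem_union, not_or]
    refine ⟨?_, huF.2⟩
    rintro ⟨i, rfl⟩
    exact lt_irrefl _ (huV i)
  have hfΩ : HarmonicOnNhd (fun x => S 4 (Fin.cons x y)) Ω :=
    harmonicOnNhd_of_analyticOnNhd_of_harmonicAt hΩo hΩc hFan huΩ
      (hext y hy e₀ ⟨0, 1, by decide, Or.inl rfl⟩ u (Or.inl huV))
  -- removable singularities at the points of `F ∖ range y`
  by_cases hxF : x ∈ (F : Set _)
  · set K : Set (EuclideanSpace ℝ (Fin 3)) := (range y ∪ (F : Set _)) \ {x} with hK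
    have hKc : Kᶜ ∈ 𝓝 x :=
      (hfin.subset Set.sdiff_subset).isClosed.isOpen_compl.mem_nhds fun h => h.2 rfl
    obtain ⟨r, hr, hball⟩ := Metric.mem_nhds_iff.1 hKc
    refine harmonicAt_of_harmonic_punctured_of_continuousAt
      (le_of_eq finrank_euclideanSpace_fin.symm) hr (fun w hw hwx => hfΩ w ?_)
      (continuousAt_four_cons hlim hy hx)
    have hwK : w ∉ K := hball hw
    rw [hK, Set.mem_sdiff, mem_singleton_iff, not_and, not_not] at hwK
    exact fun h => hwx (hwK h)
  · exact hfΩ x (by rw [hΩ, mem_compl_iff, mem_union, not_or]; exact ⟨hx, hxF⟩)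

include hlim htr hsc hiso hext hanF in
/-- **Step 3: `U(x) = U₄(x, y)` is harmonic at every `x ∉ range y`** (`S₄(·, y)` is, and so is
each pairing `S₂(x, yᵢ) S₂(yⱼ, y_k)`, `harmonicAt_two_left`). -/
theorem harmonicAt_connectedFour_cons (hy : Injective y) (hx : x ∉ range y) :
    HarmonicAt (fun x => limitConnectedFour S (Fin.cons x y)) x := by
  have hP : ∀ (i : Fin 3) (c : ℝ), HarmonicAt (fun x => S 2 ![x, y i] * c) x := fun i c => by
    have h := (harmonicAt_two_left htr hsc hiso (fun h => hx ⟨i, h.symm⟩ : x ≠ y i)).const_smul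
      (c := c)
    have e : (c • fun x => S 2 ![x, y i]) = fun x => S 2 ![x, y i] * c := by
      funext w; simp [mul_comm]
    rwa [e] at h
  have h := (harmonicAt_four_cons hlim hext hanF hy hx).sub
    (((hP 0 (S 2 ![y 1, y 2])).add (hP 1 (S 2 ![y 0, y 2]))).add (hP 2 (S 2 ![y 0, y 1])))
  have e : (fun x => limitConnectedFour S (Fin.cons x y)) =
      (fun x => S 4 (Fin.cons x y)) - ((fun x => S 2 ![x, y 0] * S 2 ![y 1, y 2]) +
        (fun x => S 2 ![x, y 1] * S 2 ![y 0, y 2]) + fun x => S 2 ![x, y 2] * S 2 ![y 0, y 1]) := by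
    funext w; simp only [Pi.sub_apply, Pi.add_apply, limitConnectedFour_cons]
  rwa [e]

include hlim hnorm htr hsc hiso hext hanF in
/-- **Steps 4–5: `U₄(x₀, y) = 0` for `x₀ ∉ range y`.** SQUEEZE: by Lebowitz (`U ≤ 0`) and GKS II
(one pairing below `S₄`), `|U(x)|` is at most the sum of the two pairings regular at `yᵢ`, for
each `i`; these are continuous at `yᵢ` (so `U` is bounded near `yᵢ`) and tend to `0` at infinity.
EXTENSION + LIOUVILLE: `U` agrees off `range y` with an entire harmonic function
(`exists_harmonicOnNhd_univ_eq_of_finset`) tending to `0` at infinity, which vanishes identically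
(`harmonic_eq_zero_of_tendsto_cocompact`). -/
theorem limitConnectedFour_cons_eq_zero (hy : Injective y) (hx₀ : x₀ ∉ range y) :
    limitConnectedFour S (Fin.cons x₀ y) = 0 := by
  classical
  set U : EuclideanSpace ℝ (Fin 3) → ℝ := fun x => limitConnectedFour S (Fin.cons x y) with hU
  have hyne : ∀ {i j : Fin 3}, i ≠ j → y i ≠ y j := fun hij h => hij (hy h)
  -- SQUEEZE: `|U x| ≤` (the two pairings regular at `yᵢ`), `i = 0, 1, 2`
  have hsq : ∀ x, x ∉ range y →
      |U x| ≤ S 2 ![x, y 1] * S 2 ![y 0, y 2] + S 2 ![x, y 2] * S 2 ![y 0, y 1] ∧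
      |U x| ≤ S 2 ![x, y 0] * S 2 ![y 1, y 2] + S 2 ![x, y 2] * S 2 ![y 0, y 1] ∧
      |U x| ≤ S 2 ![x, y 0] * S 2 ![y 1, y 2] + S 2 ![x, y 1] * S 2 ![y 0, y 2] := by
    intro x hx
    have h0 := connectedFour_cons_nonpos hlim hy hx
    obtain ⟨g0, g1, g2⟩ := pairings_le_four_cons hlim hnorm hy hx
    have hUx := limitConnectedFour_cons S x y
    simp only [hU, abs_of_nonpos h0]
    exact ⟨by linarith, by linarith, by linarith⟩
  -- the finite singular set and harmonicity off it
  set T : Finset (EuclideanSpace ℝ (Fin 3)) := Finset.univ.image y with hT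
  have hmemT : ∀ {x}, x ∉ T → x ∉ range y := fun hx hx' => by
    obtain ⟨i, rfl⟩ := hx'
    exact hx (Finset.mem_image_of_mem y (Finset.mem_univ i))
  have hUh : ∀ x ∉ T, HarmonicAt U x := fun x hx =>
    harmonicAt_connectedFour_cons hlim htr hsc hiso hext hanF hy (hmemT hx)
  -- local bounds near the `yᵢ` from continuous majorants
  have hbd : ∀ (i : Fin 3) (g : EuclideanSpace ℝ (Fin 3) → ℝ), ContinuousAt g (y i) →
      (∀ x, x ∉ range y → |U x| ≤ g x) →
      ∃ r > 0, ∃ M : ℝ, ∀ x ∈ ball (y i) r, x ∉ T → |U x| ≤ M := by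
    intro i g hg hle
    obtain ⟨δ, hδ, h⟩ := Metric.continuousAt_iff.1 hg 1 one_pos
    refine ⟨δ, hδ, |g (y i)| + 1, fun x hx hxT => (hle x (hmemT hxT)).trans ?_⟩
    have h1 := Real.dist_eq _ _ ▸ h hx
    linarith [le_abs_self (g x), abs_sub_abs_le_abs_sub (g x) (g (y i))]
  have hc : ∀ {i j : Fin 3}, i ≠ j → ∀ c : ℝ,
      ContinuousAt (fun x => S 2 ![x, y j] * c) (y i) :=
    fun hij c => (continuousAt_two_left hlim (hyne hij)).mul continuousAt_const
  have hb : ∀ p ∈ T, ∃ r > 0, ∃ M : ℝ, ∀ x ∈ ball p r, x ∉ T → |U x| ≤ M := by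
    intro p hp
    obtain ⟨i, -, rfl⟩ := Finset.mem_image.1 hp
    fin_cases i
    · exact hbd 0 _ ((hc (by decide) _).add (hc (by decide) _)) fun x hx => (hsq x hx).1
    · exact hbd 1 _ ((hc (by decide) _).add (hc (by decide) _)) fun x hx => (hsq x hx).2.1
    · exact hbd 2 _ ((hc (by decide) _).add (hc (by decide) _)) fun x hx => (hsq x hx).2.2
  -- EXTENSION to an entire harmonic function, DECAY at infinity, LIOUVILLE
  obtain ⟨V, hV, hVU⟩ :=
    exists_harmonicOnNhd_univ_eq_of_finset (le_of_eq finrank_euclideanSpace_fin.symm) T hUh hb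
  have hV0 : Tendsto V (cocompact _) (𝓝 0) := by
    have hq : Tendsto (fun x => S 2 ![x, y 1] * S 2 ![y 0, y 2] +
        S 2 ![x, y 2] * S 2 ![y 0, y 1]) (cocompact (EuclideanSpace ℝ (Fin 3))) (𝓝 0) := by
      simpa using (tendsto_two_left_cocompact htr hsc hiso (y 1) (S 2 ![y 0, y 2])).add
        (tendsto_two_left_cocompact htr hsc hiso (y 2) (S 2 ![y 0, y 1]))
    refine squeeze_zero_norm' ?_ hq
    filter_upwards [T.finite_toSet.isCompact.compl_mem_cocompact] with x hx
    have hx' : x ∉ T := fun h => hx (by simpa using h)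
    rw [Real.norm_eq_abs, hVU x hx']
    exact (hsq x (hmemT hx')).1
  have hVz := harmonic_eq_zero_of_tendsto_cocompact hV hV0
  have hx₀T : x₀ ∉ T := fun h => by
    obtain ⟨i, -, hi⟩ := Finset.mem_image.1 h
    exact hx₀ ⟨i, hi⟩
  simpa [hVz] using (hVU x₀ hx₀T).symm

/-- **STUB 4 of line `null-laplacian-edge-gaussianity` — `stub_edgeBocherLiouville`.** Under the
crux hypotheses with `Δ = 1/2`, exterior harmonicity (STUB 2 at `m = 3`) and analyticity off a
finite set (STUB 3 at `m = 3`) force `U₄ ≡ 0` on non-coincident quadruples: write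
`z = (z₀, y)` with `y = Fin.tail z` injective and `z₀ ∉ range y`, and apply
`limitConnectedFour_cons_eq_zero` (flooding by real-analytic continuation, removable isolated
singularities in `ℝ³`, the harmonic Wick part at `Δ = 1/2`, the Lebowitz/GKS squeeze, and
Liouville's theorem for harmonic functions vanishing at infinity). -/
theorem stub_edgeBocherLiouville :
    ∀ (ρ : ℝ → ℝ) (Δ : ℝ) (S : CorrFamily 3), (∀ δ ∈ Set.Ioc (0:ℝ) 1, 0 < ρ δ) →
      HasPointwiseScalingLimit (criticalCorr 3) ρ S →
      (∀ n z, z ∉ NonCoincident 3 n → S n z = 0) → IsNondegenerateTwoPoint S →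
      IsTranslationInvariant S → IsScaleCovariant Δ S →
      (∀ (R : EuclideanSpace ℝ (Fin 3) ≃ₗᵢ[ℝ] EuclideanSpace ℝ (Fin 3))
        (x : EuclideanSpace ℝ (Fin 3)), x ≠ 0 → S 2 ![0, R x] = S 2 ![0, x]) →
      Δ = 1 / 2 →
      (∀ (y : Fin 3 → EuclideanSpace ℝ (Fin 3)), Function.Injective y →
        ∀ n : EuclideanSpace ℝ (Fin 3),
          (∃ i j : Fin 3, i ≠ j ∧ (n = EuclideanSpace.single i 1 ∨
            n = EuclideanSpace.single i 1 + EuclideanSpace.single j 1 ∨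
            n = EuclideanSpace.single i 1 - EuclideanSpace.single j 1)) →
          ∀ u : EuclideanSpace ℝ (Fin 3),
            ((∀ i, inner ℝ u n < inner ℝ (y i) n) ∨ (∀ i, inner ℝ (y i) n < inner ℝ u n)) →
            InnerProductSpace.HarmonicAt
              (fun x : EuclideanSpace ℝ (Fin 3) => S (3 + 1) (Fin.cons x y)) u) →
      (∀ (y : Fin 3 → EuclideanSpace ℝ (Fin 3)), Function.Injective y →
        ∃ F : Finset (EuclideanSpace ℝ (Fin 3)),
          AnalyticOnNhd ℝ (fun x : EuclideanSpace ℝ (Fin 3) => S (3 + 1) (Fin.cons x y))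
            (Set.range y ∪ (F : Set (EuclideanSpace ℝ (Fin 3))))ᶜ) →
      ∀ z ∈ NonCoincident 3 4, limitConnectedFour S z = 0 := by
  intro ρ Δ S _ hlim hnorm _ htr hsc hiso hΔ hext hanF z hz
  subst hΔ
  have hzinj : Function.Injective z := hz
  have hy : Function.Injective (Fin.tail z) := fun i j h => Fin.succ_injective _ (hzinj h)
  have hx₀ : z 0 ∉ range (Fin.tail z) := by
    rintro ⟨i, hi⟩
    exact Fin.succ_ne_zero i (hzinj hi)
  rw [← Fin.cons_self_tail z]
  exact limitConnectedFour_cons_eq_zero hlim hnorm htr hsc hiso hext hanF hy hx₀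

end Summit.CriticalPhenomena.Ising3DConformalLimit.Cruxes.RotationUpgradeFromTwoPoint.NullLaplacianEdgeGaussianity

end
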